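import Summits.CriticalPhenomena.CardyFormulaZ2.Theorems.CardySusyWardWeakHolomorphySplit

/-!
# Line `alias-floor` for the crux `CardySusyWard.WeakHolomorphy` (stmt-CriticalPhenomena-11292) — skeleton v2 (lead c4)

Lead prover `prover-line-stmt-CriticalPhenomena-11292-c4-0`, 2026-08-17, owning the crux-strategist's line `alias-floor`
(`planner-cstrat-stmt-CriticalPhenomena-11292-s1-0`, skeleton v1 = `Cruxes/WeakHolomorphy/Lines/alias_floor.lean`).
v2 = v1 with the glue imported from the landed `Theorems/CardySusyWardWeakHolomorphySplit.lean` once accepted (until then from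
the strategist's sorry-free `Cruxes/WeakHolomorphy/SplitGlue.lean`, byte-identical mathematics).  Two registered stubs and a
kernel-checked composition concluding the crux BY NAME:

* `stub_parafermionBulkBound` — VERBATIM clause (i) of the route's own rank-3 crux `ParafermionPrecompact`
  (stmt-CriticalPhenomena-11293): eventually `‖F^{(1/3)}_δ(z)‖ ≤ C δ^{1/3}` above every compact.  DELEGATED to that existing
  item (`parafermionBulkBound_of_precompact` is the one-line projection); not worked on this line.
* `stub_relativeAliasFloor` — for every `ε > 0`, eventually `‖F^{(−5/3)}_δ(z)‖ ≤ ε (‖F^{(1/3)}_δ(z)‖ + δ^{1/3})` at every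
  medial vertex above the compact: the spin-`−5/3` ALIAS of the route's vertex observable
  (`F^{(s)}_δ(z) = ∫ passageSum (medialExploration (Λ δ) ω) δ s z dP_{1/2}`) is POINTWISE negligible against the observable
  itself, with the floor `δ^{1/3}`.  Rate-free, envelope-free, value-free; the load-bearing stub (held by the lead).

Composition (`WeakHolomorphy_of_subs`, sorry-free): `F(NE)+F(SW)−F(NW)−F(SE) = ± Σ_k F^{(−5/3)}(c_{p,k})`
(`stub_staggeredKirchhoffEqSpinShift`, landed `…WeakHolomorphySpinShift`) and
`Σ_k F^{(−5/3)}(c_{p,k}) = 2cos(5π/12)·F^{(−5/3)}_δ(z_p)` eventually above compacts (`stub_aliasVertexEqSumEventually`,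
landed `…WeakHolomorphyAliasSplit`) turn the two stubs into `‖K_p‖ ≤ 2cos(5π/12) ε (|C|+1) δ^{1/3}` per vertex;
`stub_count` (`#{p over K} ≤ C_K δ^{-2}`) gives the `L¹` Kirchhoff law and `weakHolomorphy_of_kirchhoffL1`
(landed `…WeakHolomorphyReduction`, p137519) the crux.  Card: `Cruxes/WeakHolomorphy/Lines/alias-floor.md`.
References: Duminil-Copin–Smirnov arXiv:1109.1549 §8.3 (Prop. 8.6, Conj. 8.7); Smirnov, Ann. Math. 172 (2010) §4.
-/

noncomputable section

namespace Summit.CriticalPhenomena.CardyFormulaZ2.Cruxes.WeakHolomorphy.AliasFloor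

open scoped BigOperators Topology
open Filter Set MeasureTheory
open _root_.Literature.Probability.LatticeModels
open _root_.Literature.Probability.RandomPlanarGeometry (DobrushinDomain)
open _root_.Literature.Probability.Percolation (bondPercolation half)
open _root_.Literature.Barriers.CriticalPhenomena (medialCornersAt medialVertexOf)
open Summit.CriticalPhenomena.CardyFormulaZ2.Theorems.ParafermionPrecompact.Negative (IsFamily)
open Summit.CriticalPhenomena.CardyFormulaZ2.Theorems.WeakHolomorphy.SplitBypass
open Summit.CriticalPhenomena.CardyFormulaZ2.Theorems.WeakHolomorphy.AliasFloor (WeakHolomorphy_of_subs)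

/-- **`stub_parafermionBulkBound`** (= `ParafermionPrecompact` (i), stmt-11293, verbatim; OPEN, summit-grade on `ℤ²` —
sharp two-arm exponent `1/4` plus the `δ^{1/12}` winding cancellation — but owed by the route independently of this crux):
along every admissible family, above every compact `K ⊂ Ω`, eventually `‖F^{(1/3)}_δ(z)‖ ≤ C δ^{1/3}`.
[cite: DuminilCopinSmirnov2012Lattice, Conjecture 8.7] -/
theorem stub_parafermionBulkBound : ∀ (D : Literature.Probability.RandomPlanarGeometry.DobrushinDomain) (Λ : ℝ → Literature.Probability.LatticeModels.DiscreteDobrushin), (∀ δ, (Λ δ).Ω = D.carrier) → (∀ δ, (Λ δ).δ = δ) → Filter.Tendsto (fun δ : ℝ => Metric.hausdorffEDist (Λ δ).arcA (D.arc 0)) (nhdsWithin (0:ℝ) (Set.Ioi 0)) (nhds 0) → Filter.Tendsto (fun δ : ℝ => Metric.hausdorffEDist (Λ δ).arcB (D.arc 1)) (nhdsWithin (0:ℝ) (Set.Ioi 0)) (nhds 0) → Filter.Tendsto (fun δ : ℝ => Metric.hausdorffEDist (Literature.Probability.LatticeModels.medialPoint δ '' (Λ δ).zdABEdges) {D.pt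 0, D.pt 1}) (nhdsWithin (0:ℝ) (Set.Ioi 0)) (nhds 0) → (∀ᶠ δ in nhdsWithin (0:ℝ) (Set.Ioi 0), (Λ δ).IsZdAdmissible) → ∀ K : Set ℂ, IsCompact K → K ⊆ D.carrier → ∃ C : ℝ, ∀ᶠ δ in nhdsWithin (0:ℝ) (Set.Ioi 0), ∀ z : Literature.Probability.LatticeModels.MedialVertex, Literature.Probability.LatticeModels.medialPoint δ z ∈ K → ‖(∫ ω, Literature.Probability.LatticeModels.MedialPath.passageSum (Literature.Probability.LatticeModels.medialExploration (Λ δ) ω) δ (1 / 3) z ∂(Literature.Probability.Percolation.bondPercolation (Literature.Probability.LatticeModels.zdGraph 2) Literature.Probability.Percolation.half))‖ ≤ C * δ ^ ((1:ℝ) / 3) := by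
  sorry

/-- **`stub_relativeAliasFloor`** (OPEN; the load-bearing stub): along every admissible family, above every compact
`K ⊂ Ω`, for every `ε > 0`, eventually `‖F^{(−5/3)}_δ(z)‖ ≤ ε (‖F^{(1/3)}_δ(z)‖ + δ^{1/3})` at every medial vertex `z`:
the spin-`−5/3` alias of the vertex observable is pointwise negligible against the spin-`1/3` observable (floor
`δ^{1/3}`).  By the exact alias identities this is the pointwise relative Kirchhoff law
`‖in − out‖ ≤ ε' (‖in + out‖ + δ^{1/3})` of the spin-`1/3` dart observable, i.e. the chirality law
`Z_L ≈ e^{iπ/6} Z_R` in relative form; numerically `‖F^{(−5/3)}‖/‖F^{(1/3)}‖ ≈ 0.4 δ^{5/3}/dist(z,∂Ω)`.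
[cite: DuminilCopinSmirnov2012Lattice, Conjecture 8.7] -/
theorem stub_relativeAliasFloor : ∀ (D : Literature.Probability.RandomPlanarGeometry.DobrushinDomain) (Λ : ℝ → Literature.Probability.LatticeModels.DiscreteDobrushin), (∀ δ, (Λ δ).Ω = D.carrier) → (∀ δ, (Λ δ).δ = δ) → Filter.Tendsto (fun δ : ℝ => Metric.hausdorffEDist (Λ δ).arcA (D.arc 0)) (nhdsWithin (0:ℝ) (Set.Ioi 0)) (nhds 0) → Filter.Tendsto (fun δ : ℝ => Metric.hausdorffEDist (Λ δ).arcB (D.arc 1)) (nhdsWithin (0:ℝ) (Set.Ioi 0)) (nhds 0) → Filter.Tendsto (fun δ : ℝ => Metric.hausdorffEDist (Literature.Probability.LatticeModels.medialPoint δ '' (Λ δ).zdABEdges) {D.pt 0, D.pt 1}) (nhdsWithin (0:ℝ) (Set.Ioi 0)) (nhds 0) → (∀ᶠ δ in nhdsWithin (0:ℝ) (Set.Ioi 0), (Λ δ).IsZdAdmissible) → ∀ K : Set ℂ, IsCompact K → K ⊆ D.carrier → ∀ ε > (0:ℝ), ∀ᶠ δ in nhdsWithin (0:ℝ) (Set.Ioi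 0), ∀ z : Literature.Probability.LatticeModels.MedialVertex, Literature.Probability.LatticeModels.medialPoint δ z ∈ K → ‖(∫ ω, Literature.Probability.LatticeModels.MedialPath.passageSum (Literature.Probability.LatticeModels.medialExploration (Λ δ) ω) δ (-5 / 3) z ∂(Literature.Probability.Percolation.bondPercolation (Literature.Probability.LatticeModels.zdGraph 2) Literature.Probability.Percolation.half))‖ ≤ ε * (‖(∫ ω, Literature.Probability.LatticeModels.MedialPath.passageSum (Literature.Probability.LatticeModels.medialExploration (Λ δ) ω) δ (1 / 3) z ∂(Literature.Probability.Percolation.bondPercolation (Literature.Probability.LatticeModels.zdGraph 2) Literature.Probability.Percolation.half))‖ + δ ^ ((1:ℝ) / 3)) := by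
  sorry

/-- **The line closes the crux modulo its two stubs** (the crux BY NAME; the only crux-concluding theorem of this
module): `WeakHolomorphy_of_subs stub_parafermionBulkBound stub_relativeAliasFloor`. [folklore] -/
theorem WeakHolomorphy_of : Summit.CriticalPhenomena.CardyFormulaZ2.Theses.CardySusyWard.WeakHolomorphy :=
  WeakHolomorphy_of_subs stub_parafermionBulkBound stub_relativeAliasFloor

end Summit.CriticalPhenomena.CardyFormulaZ2.Cruxes.WeakHolomorphy.AliasFloor

end
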